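import Literature.NumberTheory.LFunctions.Zhang2022.KnifeEdgeLenLongLegSplit
import Literature.NumberTheory.LFunctions.Zhang2022.Section7WindowHyperbola
import Literature.NumberTheory.LFunctions.Zhang2022.Section7ProfileSampling
import Literature.NumberTheory.LFunctions.Zhang2022.Section3Lemma34
import Literature.NumberTheory.DiophantineGeometry.SquarefulSumsCountingTools

/-!
# Zhang (2022), rung F-S3 (§D edge len, crux card `long-leg-split-chi-band`, stmt-Parity-20014 → 20446): the
# `χ`-WINDOW STRUCTURE HYPOTHESIS `ChiWindowBound` of the re-typed Leg-A long slot (slot shape of record), its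
# DISCHARGE for the cell datum `𝐚₁ = longPsiData χ b g f` ((M1)–(M4)), and LEG A RE-TYPED OVER THE `D`-DILATED
# HEAD CLASS `FormulaILongPsiDil` (repair (b) of record; OPEN — asserted by no one)

Y. Zhang, *Discrete mean estimates and the Landau–Siegel zero*, arXiv:2211.02515v1 [Zhang2022LandauSiegel] — an
unrefereed manuscript under adjudication. **WHAT THIS IS NOT: not a claim about Theorems 1–2 of arXiv:2211.02515, about
Landau–Siegel zeros, or about Parity. The programme SEARCHES and TYPES; no claim about Landau–Siegel zeros, Theorems 1–2
of arXiv:2211.02515 or a repaired Margin232 until a kernel theorem says so.** `FormulaILongPsiDil` is a bare `Prop` —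
OPEN, asserted by no one; the file ELIMINATES NOTHING (the 20446 hold is untouched). PROVED here: Parts 1–3 (the slot's
structure hypothesis as a definition with its cone algebra, and its discharge for the cell datum — finite, elementary,
(A)-free: `Σ_{n mod D} χ(n) = 0` via Pólya–Vinogradov + two Abel summations + the window hyperbola identity, all from the
tree's `Section7WindowHyperbola` (p553157/p554732) and `Section7ProfileSampling` (p556496)).

CONTEXT (cell landau-siegel, words of record; M-RULEBOOK (D5″)(c), (D5‴)(d)(iii′), (D5⁗)). Leg A = K2
`LongLegSplit.FormulaILongPsi` (`KnifeEdgeLenLongLegSplit.lean`, p543822) types Prop. 7.1's conclusion for the long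
ψ-datum `𝐚₁ = b ⋆ (χg̃) ⋆ (χf̃)` over the SUP-AMPLITUDE class (`‖b(n)‖ ≤ B·τ(n)²`, `B` before `ForAllLarge`, flat slack
`ε·𝔓`). The `𝒳₂` long cell's own ψ-datum is `𝐚₁ = D·(δ_D ⋆ υ·1_{≤D⁴}) ⋆ (χg̃) ⋆ (χf̃)` behind the prefactor `−χ(p)/τ(χ)`,
`‖τ(χ)⁻¹‖ = D^{−1/2}` (`TauTwoLowering.norm_inv_tau_eq`, p546047): K2 reaches it only by linearity at `b/D`, slack
`ε·D·𝔓` (`…/Negative/LegSplitAmplitude.formulaILongPsi_iff_amp`, p545732), SHORT BY `D^{1/2}` at the junction — the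
printed mechanism consumes `ℓ²(dm/m)`-type norms ((7.5) first Cauchy factor [p.13]; (7.15) [p.14]) on which the
`D`-dilation costs exactly `√D` (`…/Negative/DilationNorms.l2half_longPsiData_dilate_amp_D`, p548760), repaid by
`τ(χ)⁻¹`. Repairs of record: (a) a data-proportional slack `ε·𝒩(𝐚₁)·𝒩′(𝐚₂)·𝔓`; (b) a slot over the `D`-DILATED class
with slack `ε·√D·𝔓` «acceptable bookkeeping for the one customer». Part 4 types (b): `FormulaILongPsiDil` = K2's
binders VERBATIM except that the head is `dilHead D b₀ = D·(δ_D ⋆ b₀)` (`‖b₀(n)‖ ≤ B·τ(n)²`, `b₀` supported `≤ D⁴`) and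
the slack is `ε·√D·𝔓`. The main-term step (7.18)–(7.21) for long ψ-data is priced M «for the cell datum / any slot typed
with a χ-window STRUCTURE hypothesis» and > M for norm-only typings ((D5‴)(iii′), ls-knife-crit-1 2026-08-27T17:21:01Z
(p4)): on the dilated class the structure hypothesis is a THEOREM (Part 3, `chiWindowBound_dilHead`,
`chiWindowBound_x2Cell`) — the dual (l₂-first) evaluation of the desk note `ls-ref-1/D5d-iii-DUAL-v1.md` is available
for EVERY datum of the class, so no window hypothesis appears among the binders of `FormulaILongPsiDil`.

PART 1 — `ChiWindowBound a B` (ls-knife-crit-1 2026-08-27T17:22:01Z, token-for-token the local copy of the probe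
`ls-ref-1/lean/CellDatumProbe.lean` c24232311d7434ae): `∀ k ≥ 1, ∀ x h, 1 ≤ x → 0 < h ≤ x →
‖Σ_{n ∈ Ioc ⌊x⌋₊ ⌊x+h⌋₊, (n,k)=1} a n‖ ≤ B·τ(k)·√x` — (i) h-UNIFORM with an h-INDEPENDENT bound (the generator's
fingerprint), (ii) ONE side-condition form (coprimality, Möbius inside the consumer's lemma), (iii) `B` declared.
The class `{(a, B)}` is a cone (`ChiWindowBound.mono/const_mul/add/zero`).
PART 2 — the discharge for a general head `b` with `Σ_{e≤M} ‖b e‖ ≤ B_b` (ref-1's COPY-READY body, 18:49:36Z):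
`ChiWindowBound (longPsiData χ b g f) (B_b·4√2·√D(1+log D)·V_g·V_f)`, `V_g = ∫₀¹‖g′‖` — (M1) the tree lemma
`WindowHyperbola.norm_window_head_chi_conv_coprime_le` applies to the `longPsiData` goal DEFINITIONALLY, (M2)
`InClassPiece.sample_hyps` ×2, (M4) `√⌊x+h⌋₊ ≤ √2·√x`; (M3) is the hypothesis.
PART 3 — (M3) for the DILATED heads: `Σ_{e≤M} ‖dilHead D b₀ e‖ ≤ D·Σ_{a≤M/D} ‖b₀ a‖`; for the cell's `b₀ = υ·1_{≤D⁴}`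
(`upsHead χ`, `|υ| ≤ τ₂` (3.1) = `Lemma34.norm_ups_le`, Dirichlet's `Σ_{a≤N} τ(a) ≤ N(1+log N)` =
`SquarefulCount.sum_card_divisors_le`): `≤ D⁵(1 + 4 log D)`, hence `ChiWindowBound 𝐚₁ (4√2·D⁵(1+4log D)·√D(1+log D)·V_gV_f)`
= the booked «`D^{5.5+o(1)}·V_gV_f`» ((D5⁗) number correction; the exponent never enters a letter: the window bound is
spent against a power of `P = exp 𝓛⁹`, `D = P^{o(1)}`).
PART 4 — `FormulaILongPsiDil` (OPEN) and the class membership of the cell's data (ψ-side head `upsHead_norm_le`,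
`upsHead_eq_zero`; k-side `nuHead_norm_le`, `nuHead_eq_zero`: `B = 1` on both sides). The k-side binder is NOT K2's
`Adm72 D B a₂` (`‖a₂‖ ≤ B` with `B` before `ForAllLarge`: the cell's `𝐚₂ = ν·1_{≤D⁴}`, `|ν| ≤ τ₂` unbounded in `D`, is in NO
`Adm72 D B` eventually — K1A-DISPLAY-X2short (6c); ls-knife-crit-1 2026-08-27T19:55:05Z, binding) but the «k-side divisor class,
g_k = 1»: `‖a₂(n)‖ ≤ B·τ(n)`, `a₂` supported `≤ D⁴` (the customer's exact support; inside the (7.5) budget of record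
`4.5(2+g_ψ)² + 9g_k² = 72 + 9 = 81 < 127`, (D5″)(a)). NOT COVERED (tenure's line items of record, unchanged): Leg B; P2 (the
`EcalExt` bound for the dilated datum); the corner `θ_g + θ_f = 2`; the `Δ′` bound (p3); the Lemma 8.2/8.4 range extension
(p5); DISPLAY #6; wiring the slot into the route (the re-typed TRANSFER must consume exactly this binder pair). Why
`FormulaILongPsiDil` might fail: (7.11)–(7.15) re-run for the dilated datum has ZERO ROOM ((D5‴)(d)(ii): `l₂ ≡ 0 (D)`
reindexes to `l′ < 𝔍/D`), and (7.3)–(7.5) never absorbs a scalar `D^k`.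
PART 5 (appended; ls-knife-crit-1 (q)-read of DISPLAY #6 v0 2026-08-27T20:16:55Z, N1/N2/O1–O3) — THE DILATED COMPANIONS,
bare `Prop`s, OPEN: `FormulaILongDualDil` (K1-Dil: Leg B with the dilated long k-side head, ψ-side divisor class, slack
`ε·√D·𝔓` — the E1/E2 wall, NOT claimed), `Lemma81LongPsiDil` (P2-Dil: Lemma 8.1 with extended truncations for the
dilated head and divisor-class k-side, slack `ε·√D·𝔓`, corner `λ = 2` excluded), `LegSplitTransferX2Dil` (the implication
`FormulaILongPsiDil → FormulaILongDualDil → Lemma81LongPsiDil → ∃ X₂, TauTwoTablePsi c′ X₂`, a shape); the cell's Leg-B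
ψ-side datum `conj(nuHead χ)` is a class member (`conj_nuHead_norm_le/_eq_zero`). K2/K1/P2/`LegSplitTransferX2` untouched.
-/

noncomputable section

open Complex Real ComplexConjugate Finset

namespace Literature.NumberTheory.LFunctions.Zhang2022.KnifeEdge.LongLegSplit

open Repair Skeleton

/-! ### Part 1 — the structure hypothesis of the re-typed Leg-A long slot (slot shape of record) -/

/-- **`ChiWindowBound a B` — the `χ`-window STRUCTURE hypothesis** (slot shape of record, ls-knife-crit-1
2026-08-27T17:22:01Z; typing input (p4) of M-RULEBOOK (D5‴)(iii′)): for every `k ≥ 1` and every window `(x, x+h]`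
with `1 ≤ x`, `0 < h ≤ x`, the sum of `a` over the integers of the window coprime to `k` is at most
`B·τ(k)·√x` — uniformly in `h` (an `h`-floor or a bound `∝ h^{1/2+…}` would smuggle the trivial bound back). For the
cell datum it is the dual (l₂-first) evaluation's input on the range `l₂ > √P` of (7.18), generated by
`Σ_{n mod D} χ(n) = 0` inside `𝐚₁`; a general datum of the same norms (e.g. `a ≥ 0`) need not satisfy it.
[cite: Zhang2022LandauSiegel, §7 Prop. 7.1, (7.18)–(7.21) p. 15] -/
def ChiWindowBound (a : ℕ → ℂ) (B : ℝ) : Prop :=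
  ∀ k : ℕ, 1 ≤ k → ∀ x h : ℝ, 1 ≤ x → 0 < h → h ≤ x →
    ‖∑ n ∈ (Ioc ⌊x⌋₊ ⌊x + h⌋₊).filter (fun n => n.Coprime k), a n‖ ≤
      B * (k.divisors.card : ℝ) * Real.sqrt x

namespace ChiWindowBound

/-- Monotonicity in the constant. [cite: Zhang2022LandauSiegel, §7 (7.18)–(7.21) p. 15] -/
theorem mono {a : ℕ → ℂ} {B B' : ℝ} (h : ChiWindowBound a B) (hBB' : B ≤ B') : ChiWindowBound a B' :=
  fun k hk x hh hx h0 hhx => (h k hk x hh hx h0 hhx).trans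
    (mul_le_mul_of_nonneg_right (mul_le_mul_of_nonneg_right hBB' (Nat.cast_nonneg _))
      (Real.sqrt_nonneg _))

/-- The constant of a window bound is `≥ 0` (test window `k = 1`, `x = h = 1`).
[cite: Zhang2022LandauSiegel, §7 (7.18)–(7.21) p. 15] -/
theorem nonneg {a : ℕ → ℂ} {B : ℝ} (h : ChiWindowBound a B) : 0 ≤ B := by
  have h1 := h 1 le_rfl 1 1 le_rfl one_pos le_rfl
  simp only [Nat.divisors_one, Finset.card_singleton, Nat.cast_one, mul_one, Real.sqrt_one] at h1
  exact (norm_nonneg _).trans h1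

/-- The zero datum. [cite: Zhang2022LandauSiegel, §7 (7.18)–(7.21) p. 15] -/
theorem zero : ChiWindowBound (fun _ => 0) 0 := by
  intro k _ x h _ _ _
  simp

/-- Scaling: the class `{(a,B)}` is closed under `a ↦ c·a`, `B ↦ ‖c‖·B`. [cite: Zhang2022LandauSiegel, §7 (7.18)–(7.21) p. 15] -/
theorem const_mul {a : ℕ → ℂ} {B : ℝ} (h : ChiWindowBound a B) (c : ℂ) :
    ChiWindowBound (fun n => c * a n) (‖c‖ * B) := by
  intro k hk x hh hx h0 hhx
  rw [← Finset.mul_sum, norm_mul, mul_assoc, mul_assoc]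
  exact mul_le_mul_of_nonneg_left (by simpa [mul_assoc] using h k hk x hh hx h0 hhx) (norm_nonneg _)

/-- Additivity: the class `{(a,B)}` is closed under sums. [cite: Zhang2022LandauSiegel, §7 (7.18)–(7.21) p. 15] -/
theorem add {a a' : ℕ → ℂ} {B B' : ℝ} (h : ChiWindowBound a B) (h' : ChiWindowBound a' B') :
    ChiWindowBound (fun n => a n + a' n) (B + B') := by
  intro k hk x hh hx h0 hhx
  rw [Finset.sum_add_distrib, add_mul, add_mul]
  exact (norm_add_le _ _).trans (add_le_add (h k hk x hh hx h0 hhx) (h' k hk x hh hx h0 hhx))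

end ChiWindowBound

/-! ### Part 2 — the discharge for `𝐚₁ = b ⋆ (χg̃) ⋆ (χf̃)` with a general head `b` ((M1), (M2), (M4); (M3) = `hb`) -/

/-- **(M1)–(M4) composed (ls-ref-1 g9, `CellDatumProbe.lean` c24232311d7434ae, evidence #25 on stmt-Parity-20446):**
for `χ` primitive mod `D ≥ 2`, a head `b` all of whose partial `ℓ¹` sums are `≤ B_b`, and in-class pieces `g, f`,
the datum `𝐚₁ = longPsiData χ b g f` satisfies the `χ`-window bound with
`B = B_b · 4√2 · √D(1 + log D) · V_g V_f`, `V_g = ∫₀¹ ‖g′‖`, `V_f = ∫₀¹ ‖f′‖`: (M1) the tree's assembled lemma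
`WindowHyperbola.norm_window_head_chi_conv_coprime_le` applies to the `longPsiData` goal definitionally, (M2) the
profile constants `S = V = ∫₀¹‖·′‖` are `InClassPiece.sample_hyps`, (M4) `√⌊x+h⌋₊ ≤ √2·√x` for `h ≤ x`.
[cite: Zhang2022LandauSiegel, §7 Prop. 7.1, (7.18)–(7.21) p. 15; §8 (8.8)]
[cite: MontgomeryVaughan2007, §2.1, §9.4 Thm. 9.18, §1.3 Thm. 1.3] -/
theorem chiWindowBound_longPsiData {D : ℕ} (χ : DirichletCharacter ℂ D) (hχ : χ.IsPrimitive)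
    (hD : 2 ≤ D) (b : ℕ → ℂ) {Bb : ℝ} (hb : ∀ M : ℕ, ∑ e ∈ Ioc 0 M, ‖b e‖ ≤ Bb)
    {g g' f f' : ℝ → ℂ} (hg : InClassPiece g g') (hf : InClassPiece f f') :
    ChiWindowBound (longPsiData χ b g f)
      (Bb * (4 * Real.sqrt 2 * (Real.sqrt D * (1 + Real.log D)) *
        ((∫ t in (0:ℝ)..1, ‖g' t‖) * ∫ t in (0:ℝ)..1, ‖f' t‖))) := by
  intro k hk x h hx hh hhx
  -- `log P = 𝓛⁹ > 0` for `D ≥ 2` (the tree's `Typed.Sec10C.log_bigP_pos`, inlined to keep the imports local)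
  have hL : 0 < Real.log (bigP D) := by
    rw [bigP, Real.log_exp]
    exact pow_pos (Real.log_pos (by exact_mod_cast hD)) 9
  have hVg : 0 ≤ ∫ t in (0:ℝ)..1, ‖g' t‖ := InClassPiece.tv_nonneg
  have hVf : 0 ≤ ∫ t in (0:ℝ)..1, ‖f' t‖ := InClassPiece.tv_nonneg
  set Vg := ∫ t in (0:ℝ)..1, ‖g' t‖ with hVgdef
  set Vf := ∫ t in (0:ℝ)..1, ‖f' t‖ with hVfdef
  set N := ⌊x⌋₊ with hNdef
  set M := ⌊x + h⌋₊ with hMdef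
  have hk0 : k ≠ 0 := by omega
  obtain ⟨hGs, hGv⟩ := hg.sample_hyps hL M
  obtain ⟨hFs, hFv⟩ := hf.sample_hyps hL M
  -- (M1)+(M2): the tree's assembled χ-window lemma, profile constants S = V = ∫₀¹‖·′‖
  have h1 : ‖∑ n ∈ (Ioc N M).filter (fun n => n.Coprime k), longPsiData χ b g f n‖ ≤
      (∑ e ∈ Ioc 0 M, ‖b e‖) * ((k.divisors.card : ℝ) * Real.sqrt M *
        (Real.sqrt D * (1 + Real.log D)) * (Vg * (Vf + Vf) + Vf * (Vg + Vg))) :=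
    WindowHyperbola.norm_window_head_chi_conv_coprime_le χ hχ hD hk0 hVg hVf hGs hFs hGv hFv N
  -- (M4): the window's right end is at most 2x
  have hM : (M : ℝ) ≤ 2 * x := (Nat.floor_le (by linarith)).trans (by linarith)
  have hsqM : Real.sqrt M ≤ Real.sqrt 2 * Real.sqrt x := by
    rw [← Real.sqrt_mul (by norm_num : (0:ℝ) ≤ 2)]
    exact Real.sqrt_le_sqrt hM
  have hτ : 0 ≤ (k.divisors.card : ℝ) := Nat.cast_nonneg _
  have hcD : 0 ≤ Real.sqrt D * (1 + Real.log D) :=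
    mul_nonneg (Real.sqrt_nonneg _) (by have := Real.log_natCast_nonneg D; linarith)
  have hS : 0 ≤ Vg * (Vf + Vf) + Vf * (Vg + Vg) :=
    add_nonneg (mul_nonneg hVg (add_nonneg hVf hVf)) (mul_nonneg hVf (add_nonneg hVg hVg))
  have hsum : 0 ≤ ∑ e ∈ Ioc 0 M, ‖b e‖ := sum_nonneg fun _ _ => norm_nonneg _
  -- (M3) is the hypothesis `hb`; assemble
  have h2 : (k.divisors.card : ℝ) * Real.sqrt M * (Real.sqrt D * (1 + Real.log D)) *
        (Vg * (Vf + Vf) + Vf * (Vg + Vg)) ≤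
      (k.divisors.card : ℝ) * (Real.sqrt 2 * Real.sqrt x) * (Real.sqrt D * (1 + Real.log D)) *
        (Vg * (Vf + Vf) + Vf * (Vg + Vg)) :=
    mul_le_mul_of_nonneg_right (mul_le_mul_of_nonneg_right
      (mul_le_mul_of_nonneg_left hsqM hτ) hcD) hS
  calc ‖∑ n ∈ (Ioc N M).filter (fun n => n.Coprime k), longPsiData χ b g f n‖
      ≤ (∑ e ∈ Ioc 0 M, ‖b e‖) * ((k.divisors.card : ℝ) * Real.sqrt M *
          (Real.sqrt D * (1 + Real.log D)) * (Vg * (Vf + Vf) + Vf * (Vg + Vg))) := h1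
    _ ≤ Bb * ((k.divisors.card : ℝ) * (Real.sqrt 2 * Real.sqrt x) *
          (Real.sqrt D * (1 + Real.log D)) * (Vg * (Vf + Vf) + Vf * (Vg + Vg))) :=
        mul_le_mul (hb M) h2 (mul_nonneg (mul_nonneg (mul_nonneg hτ (Real.sqrt_nonneg _)) hcD) hS)
          (hsum.trans (hb M))
    _ = Bb * (4 * Real.sqrt 2 * (Real.sqrt D * (1 + Real.log D)) * (Vg * Vf)) *
          (k.divisors.card : ℝ) * Real.sqrt x := by ring

/-! ### Part 3 — (M3) for the `D`-dilated heads, and the `𝒳₂` cell's own head `D·(δ_D ⋆ υ·1_{≤D⁴})` -/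

/-- **The `D`-dilated head with amplitude `D`**: `dilHead D b₀ d = D·b₀(d/D)` if `D ∣ d`, else `0` — i.e.
`D·(δ_D ⋆ b₀)`, the convention of `…/LongPairsGradedTables/Negative/DilationNorms.lean` (p548760) at `A = D`. The `𝒳₂`
long cell's ψ-side head is `dilHead D (υ·1_{≤D⁴})` (K1A-DISPLAY-X2short §1 (5): `𝐚₁ = D·(δ_D ⋆ υ·1_{≤D⁴} ⋆ χg ⋆ χf)`,
from `A(𝐚₁;s,ψ) = ψ(D)D^{1−s}G(s,ψ)Q_g(s)H_f(s)` after the (M4)+Lemma 4.8 lowering).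
[cite: Zhang2022LandauSiegel, §4 Lemma 4.8 p. 9; §8 Lemma 8.1, (8.8) p. 16] -/
def dilHead (D : ℕ) (b₀ : ℕ → ℂ) (d : ℕ) : ℂ := if D ∣ d then (D : ℂ) * b₀ (d / D) else 0

/-- Unfolding `dilHead`. [cite: Zhang2022LandauSiegel, §8 (8.8) p. 16] -/
theorem dilHead_apply (D : ℕ) (b₀ : ℕ → ℂ) (d : ℕ) :
    dilHead D b₀ d = if D ∣ d then (D : ℂ) * b₀ (d / D) else 0 := rfl

/-- On the multiples of `D`: `dilHead D b₀ (D·a) = D·b₀(a)` (`0 < D`). [cite: Zhang2022LandauSiegel, §8 (8.8) p. 16] -/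
theorem dilHead_mul {D : ℕ} (hD : 0 < D) (b₀ : ℕ → ℂ) (a : ℕ) :
    dilHead D b₀ (D * a) = (D : ℂ) * b₀ a := by
  rw [dilHead, if_pos (dvd_mul_right D a), Nat.mul_div_cancel_left a hD]

/-- Off the multiples of `D` the dilated head vanishes. [cite: Zhang2022LandauSiegel, §8 (8.8) p. 16] -/
theorem dilHead_eq_zero_of_not_dvd {D : ℕ} (b₀ : ℕ → ℂ) {d : ℕ} (hd : ¬ D ∣ d) : dilHead D b₀ d = 0 := by
  rw [dilHead, if_neg hd]

/-- The support of the dilated head: if `b₀` vanishes above `N`, `dilHead D b₀` vanishes above `D·N`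
(so a head `b₀` supported `≤ D⁴` gives `b` supported `≤ D⁵`, K2's support binder).
[cite: Zhang2022LandauSiegel, §7 (7.2) p. 13; §8 (8.8) p. 16] -/
theorem dilHead_eq_zero_of_lt {D N : ℕ} (b₀ : ℕ → ℂ) (hb₀ : ∀ n : ℕ, N < n → b₀ n = 0) {d : ℕ}
    (hd : D * N < d) : dilHead D b₀ d = 0 := by
  unfold dilHead
  split_ifs with hDd
  · obtain ⟨a, rfl⟩ := hDd
    rcases Nat.eq_zero_or_pos D with rfl | hD
    · simp
    · rw [Nat.mul_div_cancel_left a hD, hb₀ a (Nat.lt_of_mul_lt_mul_left hd), mul_zero]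
  · rfl

/-- **(M3) for dilated heads:** the partial `ℓ¹` sums of `dilHead D b₀` are `D ×` those of `b₀`:
`Σ_{e ≤ M} ‖dilHead D b₀ e‖ ≤ D · B₀` whenever every partial sum `Σ_{a ≤ M′} ‖b₀ a‖ ≤ B₀` (`0 < D`).
[cite: Zhang2022LandauSiegel, §7 (7.18)–(7.21) p. 15; §8 (8.8) p. 16] -/
theorem sum_norm_dilHead_le {D : ℕ} (hD : 0 < D) (b₀ : ℕ → ℂ) {B₀ : ℝ}
    (hb₀ : ∀ M' : ℕ, ∑ a ∈ Ioc 0 M', ‖b₀ a‖ ≤ B₀) (M : ℕ) :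
    ∑ e ∈ Ioc 0 M, ‖dilHead D b₀ e‖ ≤ D * B₀ := by
  classical
  -- only the multiples of `D` contribute
  have hsplit : ∑ e ∈ Ioc 0 M, ‖dilHead D b₀ e‖ =
      ∑ e ∈ (Ioc 0 M).filter (fun e => D ∣ e), (D : ℝ) * ‖b₀ (e / D)‖ := by
    rw [Finset.sum_filter]
    refine Finset.sum_congr rfl fun e _ => ?_
    unfold dilHead
    split_ifs with h
    · rw [norm_mul, Complex.norm_natCast]
    · rw [norm_zero]
  -- reindex `e = D·a`, `a ∈ Ioc 0 (M/D)`
  have himage : (Ioc 0 M).filter (fun e => D ∣ e) ⊆ (Ioc 0 (M / D)).image (fun a => D * a) := by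
    intro e he
    rw [Finset.mem_filter, Finset.mem_Ioc] at he
    obtain ⟨⟨he0, heM⟩, a, rfl⟩ := he
    refine Finset.mem_image.mpr ⟨a, Finset.mem_Ioc.mpr ⟨?_, ?_⟩, rfl⟩
    · exact Nat.pos_of_ne_zero (by rintro rfl; simp at he0)
    · exact (Nat.le_div_iff_mul_le hD).mpr (by rwa [mul_comm] at heM)
  have hnn : ∀ e ∈ (Ioc 0 (M / D)).image (fun a => D * a), 0 ≤ (D : ℝ) * ‖b₀ (e / D)‖ :=
    fun e _ => mul_nonneg (Nat.cast_nonneg _) (norm_nonneg _)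
  rw [hsplit]
  refine (Finset.sum_le_sum_of_subset_of_nonneg himage fun e he _ => hnn e he).trans ?_
  rw [Finset.sum_image fun a _ a' _ h => Nat.eq_of_mul_eq_mul_left hD h]
  simp_rw [Nat.mul_div_cancel_left _ hD]
  rw [← Finset.mul_sum]
  exact mul_le_mul_of_nonneg_left (hb₀ (M / D)) (Nat.cast_nonneg _)

/-- **The `χ`-window bound for every datum of the dilated class:** head `b = dilHead D b₀` with the partial `ℓ¹`
sums of `b₀` bounded by `B₀` ⇒ `ChiWindowBound (longPsiData χ (dilHead D b₀) g f) (D·B₀·4√2·√D(1+log D)·V_gV_f)` —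
the structure hypothesis (p4) is automatic on the class of `FormulaILongPsiDil` (Part 4).
[cite: Zhang2022LandauSiegel, §7 Prop. 7.1, (7.18)–(7.21) p. 15; §8 (8.8)]
[cite: MontgomeryVaughan2007, §2.1, §9.4 Thm. 9.18] -/
theorem chiWindowBound_dilHead {D : ℕ} (χ : DirichletCharacter ℂ D) (hχ : χ.IsPrimitive) (hD : 2 ≤ D)
    (b₀ : ℕ → ℂ) {B₀ : ℝ} (hb₀ : ∀ M' : ℕ, ∑ a ∈ Ioc 0 M', ‖b₀ a‖ ≤ B₀)
    {g g' f f' : ℝ → ℂ} (hg : InClassPiece g g') (hf : InClassPiece f f') :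
    ChiWindowBound (longPsiData χ (dilHead D b₀) g f)
      ((D : ℝ) * B₀ * (4 * Real.sqrt 2 * (Real.sqrt D * (1 + Real.log D)) *
        ((∫ t in (0:ℝ)..1, ‖g' t‖) * ∫ t in (0:ℝ)..1, ‖f' t‖))) :=
  chiWindowBound_longPsiData χ hχ hD (dilHead D b₀)
    (sum_norm_dilHead_le (by omega) b₀ hb₀) hg hf

section Cell

variable {D : ℕ} (χ : DirichletCharacter ℂ D)

/-- **The `𝒳₂` cell's undilated head `υ·1_{≤D⁴}`** (`υ = μ ∗ μχ` = `Skeleton.ups χ`, the coefficients of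
`G(s,ψ) = Σ_{n≤D⁴} υ(n)ψ(n)n^{−s}`; `Skeleton.trunc`): the cell's ψ-side head is `dilHead D (upsHead χ)`.
[cite: Zhang2022LandauSiegel, §3 p. 6 (definition of `υ`), §4 Lemma 4.8 p. 9] -/
def upsHead : ℕ → ℂ := trunc (D ^ 4) (ups χ)

/-- Unfolding `upsHead`. [cite: Zhang2022LandauSiegel, §3 p. 6] -/
theorem upsHead_apply (n : ℕ) : upsHead χ n = if n ≤ D ^ 4 then ups χ n else 0 := rfl

/-- `upsHead` vanishes above `D⁴` (the support binder of `FormulaILongPsiDil` for the cell's head).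
[cite: Zhang2022LandauSiegel, §4 Lemma 4.8 p. 9] -/
theorem upsHead_eq_zero {n : ℕ} (hn : D ^ 4 < n) : upsHead χ n = 0 := by
  rw [upsHead_apply, if_neg (not_le.mpr hn)]

/-- **`|υ(n)| ≤ τ₂(n) ≤ τ₂(n)²`**: the cell's undilated head lies in the class of `FormulaILongPsiDil` with `B = 1`
((3.1), the tree's `Lemma34.norm_ups_le`). [cite: Zhang2022LandauSiegel, §3 (3.1) p. 6] -/
theorem upsHead_norm_le (n : ℕ) : ‖upsHead χ n‖ ≤ 1 * ((Nat.divisors n).card : ℝ) ^ 2 := by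
  rw [one_mul, upsHead_apply]
  have hτ : ‖ups χ n‖ ≤ (n.divisors.card : ℝ) := by
    rw [← MeanSquareMajorant.tau_two_apply]; exact Lemma34.norm_ups_le χ n
  split_ifs
  · refine hτ.trans ?_
    rcases Nat.eq_zero_or_pos n with rfl | hn
    · simp
    · have h1 : (1 : ℝ) ≤ n.divisors.card := by
        exact_mod_cast Finset.card_pos.mpr ⟨1, Nat.one_mem_divisors.mpr hn.ne'⟩
      nlinarith
  · rw [norm_zero]; positivity

/-- **(M3) for the cell's undilated head:** `Σ_{a ≤ M} ‖υ·1_{≤D⁴}(a)‖ ≤ Σ_{a ≤ D⁴} τ(a) ≤ D⁴(1 + 4 log D)`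
(`|υ| ≤ τ₂` and Dirichlet's bound `Σ_{n≤N} τ(n) ≤ N(1 + log N)` = `SquarefulCount.sum_card_divisors_le`).
[cite: Zhang2022LandauSiegel, §3 (3.1) p. 6] [cite: MontgomeryVaughan2007, §2.1 Thm. 2.3] -/
theorem sum_norm_upsHead_le (M : ℕ) :
    ∑ a ∈ Ioc 0 M, ‖upsHead χ a‖ ≤ (D : ℝ) ^ 4 * (1 + 4 * Real.log D) := by
  classical
  have hstep : ∑ a ∈ Ioc 0 M, ‖upsHead χ a‖ =
      ∑ a ∈ (Ioc 0 M).filter (fun a => a ≤ D ^ 4), ‖ups χ a‖ := by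
    rw [Finset.sum_filter]
    refine Finset.sum_congr rfl fun a _ => ?_
    rw [upsHead_apply]
    split_ifs <;> simp
  have hsub : (Ioc 0 M).filter (fun a => a ≤ D ^ 4) ⊆ Icc 1 (D ^ 4) := by
    intro a ha
    rw [Finset.mem_filter, Finset.mem_Ioc] at ha
    exact Finset.mem_Icc.mpr ⟨ha.1.1, ha.2⟩
  rw [hstep]
  calc ∑ a ∈ (Ioc 0 M).filter (fun a => a ≤ D ^ 4), ‖ups χ a‖
      ≤ ∑ a ∈ Icc 1 (D ^ 4), ‖ups χ a‖ :=
        Finset.sum_le_sum_of_subset_of_nonneg hsub fun _ _ _ => norm_nonneg _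
    _ ≤ ∑ a ∈ Icc 1 (D ^ 4), (a.divisors.card : ℝ) :=
        Finset.sum_le_sum fun a _ => by
          rw [← MeanSquareMajorant.tau_two_apply]; exact Lemma34.norm_ups_le χ a
    _ ≤ (D ^ 4 : ℕ) * (1 + Real.log (D ^ 4 : ℕ)) :=
        Literature.NumberTheory.DiophantineGeometry.SquarefulCount.sum_card_divisors_le (D ^ 4)
    _ = (D : ℝ) ^ 4 * (1 + 4 * Real.log D) := by
        push_cast
        rw [Real.log_pow]
        ring

/-- **The `𝒳₂` cell datum satisfies the slot's structure hypothesis with the booked constant**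
(«`ChiWindowBound 𝐚₁ (D^{O(1)}·V_gV_f)`», M-RULEBOOK (D5⁗) number correction): for `χ` primitive mod `D ≥ 2` and
in-class pieces `g, f`,
`ChiWindowBound (longPsiData χ (dilHead D (upsHead χ)) g f) (D⁵(1 + 4 log D)·4√2·√D(1 + log D)·V_gV_f)`.
No Assumption (A), no zero-free region, no `t₀/ε₁/δ(s)`.
[cite: Zhang2022LandauSiegel, §7 Prop. 7.1, (7.18)–(7.21) p. 15; §8 Lemma 8.1 (8.8) p. 16; §3 (3.1)]
[cite: MontgomeryVaughan2007, §2.1, §9.4 Thm. 9.18, §1.3 Thm. 1.3] -/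
theorem chiWindowBound_x2Cell (hχ : χ.IsPrimitive) (hD : 2 ≤ D) {g g' f f' : ℝ → ℂ}
    (hg : InClassPiece g g') (hf : InClassPiece f f') :
    ChiWindowBound (longPsiData χ (dilHead D (upsHead χ)) g f)
      ((D : ℝ) ^ 5 * (1 + 4 * Real.log D) * (4 * Real.sqrt 2 * (Real.sqrt D * (1 + Real.log D)) *
        ((∫ t in (0:ℝ)..1, ‖g' t‖) * ∫ t in (0:ℝ)..1, ‖f' t‖))) := by
  have h := chiWindowBound_dilHead χ hχ hD (upsHead χ) (sum_norm_upsHead_le χ) hg hf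
  have hD' : (D : ℝ) * ((D : ℝ) ^ 4 * (1 + 4 * Real.log D)) = (D : ℝ) ^ 5 * (1 + 4 * Real.log D) := by ring
  rwa [hD'] at h

/-- **The `𝒳₂` cell's k-side datum `ν·1_{≤D⁴}`** (`ν = 1 ∗ χ` = `Skeleton.nu χ`, the coefficients of
`F(1−s,ψ̄) = Σ_{n≤D⁴} ν(n)ψ̄(n)n^{s−1}` = `Skeleton.FpolyBar` over `Icc 1 (D⁴)`): the customer's `𝐚₂`.
[cite: Zhang2022LandauSiegel, §3 p. 6 (definition of `ν`), §4 Lemma 4.8 p. 9] -/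
def nuHead : ℕ → ℂ := trunc (D ^ 4) (nu χ)

/-- Unfolding `nuHead`. [cite: Zhang2022LandauSiegel, §3 p. 6] -/
theorem nuHead_apply (n : ℕ) : nuHead χ n = if n ≤ D ^ 4 then nu χ n else 0 := rfl

/-- `nuHead` vanishes above `D⁴` (the k-side support binder of `FormulaILongPsiDil`).
[cite: Zhang2022LandauSiegel, §4 Lemma 4.8 p. 9] -/
theorem nuHead_eq_zero {n : ℕ} (hn : D ^ 4 < n) : nuHead χ n = 0 := by
  rw [nuHead_apply, if_neg (not_le.mpr hn)]

/-- **`|ν(n)| ≤ τ₂(n)`**: the cell's k-side datum lies in the «k-side divisor class, `g_k = 1`» of `FormulaILongPsiDil`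
with `B = 1` ((3.1), the tree's `Lemma34.norm_nu_le`) — whereas it lies in NO `Adm72 D B` eventually (`τ₂` is unbounded
on `n ≤ D⁴`). [cite: Zhang2022LandauSiegel, §3 (3.1) p. 6; §7 (7.2) p. 13] -/
theorem nuHead_norm_le (n : ℕ) : ‖nuHead χ n‖ ≤ 1 * ((Nat.divisors n).card : ℝ) := by
  rw [one_mul, nuHead_apply]
  split_ifs
  · rw [← MeanSquareMajorant.tau_two_apply]; exact Lemma34.norm_nu_le χ n
  · rw [norm_zero]; positivity

end Cell

/-! ### Part 4 — LEG A RE-TYPED OVER THE `D`-DILATED HEAD CLASS (bare `Prop`, OPEN — asserted by no one) -/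

section Slot

variable (c' : ℝ)

/-- **LEG A RE-TYPED = `FormulaILongPsiDil` (repair (b) of record, M-RULEBOOK (D5″)(c); OPEN — asserted by no one).**
Prop. 7.1's conclusion for the long ψ-datum `𝐚₁ = dilHead D b₀ ⋆ (χg̃) ⋆ (χf̃)` — head `D·(δ_D ⋆ b₀)` with
`‖b₀(n)‖ ≤ B·τ(n)²`, `b₀` supported `≤ D⁴` (so `b` is supported `≤ D⁵` as in K2), `g, f` in-class pieces
sup-normalised on `[0,1]`, ANY log-length `θ_g + θ_f ≤ 2`, ψ-side truncation `Nlong D`, k-side `⌈PT⁻²⌉` — against TINY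
divisor-bounded k-side data «k-side divisor class, `g_k = 1`»: `‖𝐚₂(n)‖ ≤ B·τ(n)`, `𝐚₂` supported `≤ D⁴` (NOT K2's
`Adm72 D B`: with `B` bound before `ForAllLarge` the customer's `𝐚₂ = ν·1_{≤D⁴}`, `|ν| ≤ τ₂`, lies in no `Adm72 D B`
eventually — ls-knife-crit-1 2026-08-27T19:55:05Z, binding; K1A-DISPLAY-X2short (6c); the pair ψ-side `τ²`-head ⊗ k-side
`τ¹` sits inside the (7.5) budget of record `4.5(2+g_ψ)² + 9g_k² = 72 + 9 = 81 < 127`, (D5″)(a); support `D⁴` is the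
customer's exact support, narrower than `PT⁻²`), with slack **`ε·√D·𝔓`**: the binders of K2 `FormulaILongPsi` VERBATIM
except the head (dilated class), the k-side class, and the slack (`√D` in place of the `D` that K2 yields here by
linearity at amplitude `A = D`, `…/Negative/LegSplitAmplitude.formulaILongPsi_iff_amp`). WHY `√D`: the printed mechanism
consumes `ℓ²(dm/m)`-type norms of `𝐚₁` ((7.5) first Cauchy factor [p. 13], (7.15) [p. 14], (7.18)–(7.19) `ℓ¹(dm/m)`
[p. 15]) and the `D`-dilation multiplies the `ℓ²(dm/m)` norm by EXACTLY `√D`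
(`…/Negative/DilationNorms.l2half_longPsiData_dilate_amp_D`; `ℓ¹(dm/m)` invariant) — this is repair (a)'s data-proportional
slack `ε·𝒩(𝐚₁)·𝒩′(𝐚₂)·𝔓` evaluated on the dilated class; at the junction `τ(χ)⁻¹` (`‖τ(χ)⁻¹‖ = D^{−1/2}`) repays it.
The `𝒳₂` cell's data are the members `b₀ = upsHead χ = υ·1_{≤D⁴}` and `𝐚₂ = nuHead χ = ν·1_{≤D⁴}`, `B = 1` on both sides
(`upsHead_norm_le/eq_zero`, `nuHead_norm_le/eq_zero`). The χ-window STRUCTURE of (D5‴)(iii′)(p4) is a THEOREM on this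
class (`chiWindowBound_dilHead`), whence the price of record M at (7.18)–(7.21) (dual l₂-first evaluation; inputs
PV/Abel + the `Δ′` bound (p3)); (7.3)–(7.5) and (7.11)–(7.15) must be RE-RUN for the dilated datum (L, zero room at
(7.15): `l₂ ≡ 0 (D)` reindexes to `l′ < 𝔍/D`; a scalar `D^k` is never absorbed at (7.5)). Why it might fail: exactly
there. NOT COVERED: Leg B; P2; the corner `θ_g + θ_f = 2`; (p3); (p5); the transfer (which must consume exactly this
binder pair). [cite: Zhang2022LandauSiegel, §7 Prop. 7.1, (7.2), (7.5) p. 13, (7.11)–(7.15) p. 14, (7.18)–(7.21) p. 15;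
§8 Lemma 8.1 p. 16; §3 (3.1)] -/
def FormulaILongPsiDil : Prop :=
  ∀ B : ℝ, ∀ ε : ℝ, 0 < ε → ∃ C : ℝ, ForAllLarge fun D _ χ => AssumptionA D χ →
    ∀ (b₀ : ℕ → ℂ) (g g' f f' : ℝ → ℂ) (a₂ : ℕ → ℂ),
      InClassPiece g g' → InClassPiece f f' →
      (∀ x ∈ Set.Icc (0:ℝ) 1, ‖g x‖ ≤ 1) → (∀ x ∈ Set.Icc (0:ℝ) 1, ‖f x‖ ≤ 1) →
      (∀ n, ‖b₀ n‖ ≤ B * ((Nat.divisors n).card : ℝ) ^ 2) → (∀ n : ℕ, D ^ 4 < n → b₀ n = 0) →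
      (∀ n, ‖a₂ n‖ ≤ B * ((Nat.divisors n).card : ℝ)) → (∀ n : ℕ, D ^ 4 < n → a₂ n = 0) →
        ‖Theta1Ext c' χ (Nlong D) (Nsupp D) (longPsiData χ (dilHead D b₀) g f) a₂
            - mainMVExt c' D (Nlong D) (Nsupp D) (longPsiData χ (dilHead D b₀) g f) a₂‖
          ≤ C * EcalExt c' D (Nlong D) (Nsupp D) (longPsiData χ (dilHead D b₀) g f) a₂
            + ε * Real.sqrt D * frakP D

end Slot

/-- The dilated head of a class member is supported `≤ D⁵` = K2's support binder (`D·D⁴`).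
[cite: Zhang2022LandauSiegel, §7 (7.2) p. 13; §8 (8.8) p. 16] -/
theorem dilHead_eq_zero_of_pow_five_lt {D : ℕ} (b₀ : ℕ → ℂ) (hb₀ : ∀ n : ℕ, D ^ 4 < n → b₀ n = 0)
    {d : ℕ} (hd : D ^ 5 < d) : dilHead D b₀ d = 0 :=
  dilHead_eq_zero_of_lt b₀ hb₀ (by rwa [← pow_succ'] )

/-- The cell's full head `dilHead D (upsHead χ)` is supported `≤ D⁵`. [cite: Zhang2022LandauSiegel, §4 Lemma 4.8 p. 9; §8 (8.8)] -/
theorem dilHead_upsHead_eq_zero {D : ℕ} (χ : DirichletCharacter ℂ D) {d : ℕ} (hd : D ^ 5 < d) :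
    dilHead D (upsHead χ) d = 0 :=
  dilHead_eq_zero_of_pow_five_lt (upsHead χ) (fun _ hn => upsHead_eq_zero χ hn) hd

/-! ### Part 5 — THE DILATED COMPANIONS: Leg B (`FormulaILongDualDil`, K1-Dil), Lemma 8.1 (`Lemma81LongPsiDil`, P2-Dil)
and the transfer shape (`LegSplitTransferX2Dil`) — bare `Prop`s, OPEN, asserted by no one (ls-knife-crit-1 (q)-read of
DISPLAY #6 v0, 2026-08-27T20:16:55Z, binding typing words N1/N2, owed list O1–O3: «every slot the cell datum enters at
amplitude D is re-typed on the dilated class with √D slack and every tiny-side bounded binder widened to the divisor class») -/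

section DilCompanions

variable (c' : ℝ)

/-- **LEG B RE-TYPED = `FormulaILongDualDil` (K1-Dil; OPEN — asserted by no one; a K-len knife-edge line, NOT claimed:
the ESTAR E1/E2 wall for fixed `λ > 1`, priced in HOME/knife/len/CARD-long-leg-split-chi-band.md §Barriers (a)–(j); locus
(a′): the `P^{(λ−1)/2}` wall is met already at the Ψ₂-extension (7.3)/(7.5)).** Prop. 7.1's conclusion for TINY ψ-side
data in the «divisor class, `g = 1`» (`‖𝐚₁(n)‖ ≤ B·τ(n)`, `𝐚₁` supported `≤ D⁴`; the cell's `conj(ν·1_{≤D⁴})`, `B = 1`)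
against LONG k-side data `𝐚₂ = conj(dilHead D b₀ ⋆ (χg̃) ⋆ (χf̃))` (`‖b₀(n)‖ ≤ B·τ(n)²`, `b₀` supported `≤ D⁴`,
`g, f` sup-normalised in-class pieces, log-length `λ ∈ [1,2]`, k-side truncation `Nlong D`), with slack **`ε·√D·𝔓`**:
the binders of K1 `FormulaILongDual` VERBATIM except the dilated head, the ψ-side class (K1's `Adm72 D B a₁` is
customer-vacuous for `conj(ν·1_{≤D⁴})`, exactly as on Leg A's k-side) and the slack (`√D` for the `D` that K1 yields at
amplitude `D` by `…/Negative/LegSplitAmplitudeDual.formulaILongDual_iff_amp`). Why it might fail: it is the wall — reciprocity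
moduli `k ≍ P^λD^{O(1)} > p`, the dual large sieve (7.15) loses `P^{(λ−1)/2}` [p. 14]; beyond that, (7.3)–(7.5) for long
k-side data violates (L1) [p. 13]. [cite: Zhang2022LandauSiegel, §7 Prop. 7.1, (7.2), (7.3)–(7.5) p. 13, (7.7)–(7.9),
(7.15) p. 14; §8 Lemma 8.1 p. 16] -/
def FormulaILongDualDil : Prop :=
  ∀ B : ℝ, ∀ ε : ℝ, 0 < ε → ∃ C : ℝ, ForAllLarge fun D _ χ => AssumptionA D χ →
    ∀ (b₀ : ℕ → ℂ) (g g' f f' : ℝ → ℂ) (a₁ : ℕ → ℂ),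
      InClassPiece g g' → InClassPiece f f' →
      (∀ x ∈ Set.Icc (0:ℝ) 1, ‖g x‖ ≤ 1) → (∀ x ∈ Set.Icc (0:ℝ) 1, ‖f x‖ ≤ 1) →
      (∀ n, ‖b₀ n‖ ≤ B * ((Nat.divisors n).card : ℝ) ^ 2) → (∀ n : ℕ, D ^ 4 < n → b₀ n = 0) →
      (∀ n, ‖a₁ n‖ ≤ B * ((Nat.divisors n).card : ℝ)) → (∀ n : ℕ, D ^ 4 < n → a₁ n = 0) →
        ‖Theta1Ext c' χ (Nsupp D) (Nlong D) a₁ (fun n => conj (longPsiData χ (dilHead D b₀) g f n))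
            - mainMVExt c' D (Nsupp D) (Nlong D) a₁ (fun n => conj (longPsiData χ (dilHead D b₀) g f n))‖
          ≤ C * EcalExt c' D (Nsupp D) (Nlong D) a₁ (fun n => conj (longPsiData χ (dilHead D b₀) g f n))
            + ε * Real.sqrt D * frakP D

/-- **LEMMA 8.1 WITH EXTENDED TRUNCATIONS, RE-TYPED = `Lemma81LongPsiDil` (P2-Dil; OPEN — asserted by no one), total-length
side condition IN THE BINDERS.** For `𝐚₁ = dilHead D b₀ ⋆ (χg̃) ⋆ (χf̃)` with SHORT pieces of lengths `θ_g + θ_f ≤ 2 − δ`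
(`δ > 0`; the corner `λ = 2` is NOT covered, as in P2) and TINY divisor-class k-side data (`‖𝐚₂(n)‖ ≤ B·τ(n)`, support
`≤ D⁴`; the cell's `ν·1_{≤D⁴}`): `ΣΣ𝔠*A(𝐚₁)A(𝐚₂)ω = Θ₁Ext(Nlong,Nsupp)(𝐚₁,𝐚₂) + conj Θ₁Ext(Nsupp,Nlong)(𝐚̄₂,𝐚̄₁)` up to
**`ε·√D·𝔓`** — P2 `Lemma81LongPsi`'s binders VERBATIM except the dilated head, the k-side class (P2's `‖a₂‖ ≤ B`,
`a₂ = 0 for D⁴ ≤ n` is customer-vacuous for `ν·1_{≤D⁴}`: unbounded `τ₂`-majorant and a term AT `n = D⁴`; ls-knife-crit-1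
N1, ls-theory (P2′) 2026-08-27T20:14:33Z) and the slack (`√D` for the `D` that P2 yields at amplitude `D` by
`…/Negative/LegSplitAmplitudeDual.lemma81LongPsi_iff_amp`). PRICE (ls-theory 2026-08-27T20:19:23Z, letters of
record: typing S / proof M): the reflection identity and the contour shift `𝔍(α) → 𝔍(1)` are length- and amplitude-blind;
the ONLY lossy step of Lemma 8.1's proof is `𝔠̃ ↦ 𝔠` [p. 16 L80–L100] (error `≪ 𝓛⁻¹¹⁴·∫|L L A(𝐚₁)A(𝐚₂)ω|`, Cauchy over
`ψ ∈ Ψ₁`, Lemma 6.1 + the second assertion of Lemma 3.3), and on the dilated datum the modulus `|ψ(D)D^{1−s}| = D^{1/2−α}`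
is independent of `ψ` and of `v` on `𝔍(α)`, so it comes OUT of the `ψ`-mean-square verbatim: the error is exactly `√D ×`
(printed), i.e. the slack `ε·√D·𝔓`, CARRIED (never absorbed) and repaid by `‖τ(χ)⁻¹‖ = D^{−1/2}` at the junction; the
k-side divisor widening costs `Σ_{n≤D⁴} τ(n)²/n = 𝓛^{O(1)}` inside the log-power room; the dilated support `D⁴P^{λ}`
stays in P2's length regime `≤ P^{2−δ+o(1)}` (corner still excluded). Why it might fail: only if a second amplitude- or
length-dependent step hides in the `𝔠̃ ↦ 𝔠` bookkeeping. [cite: Zhang2022LandauSiegel, §8 Lemma 8.1 p. 16, Lemma 3.3,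
Lemmas 5.2 and 5.9, Lemma 6.1; §7 (7.2)] -/
def Lemma81LongPsiDil : Prop :=
  ∀ δ : ℝ, 0 < δ → ∀ B : ℝ, ∀ ε : ℝ, 0 < ε → ForAllLarge fun D _ χ => AssumptionA D χ →
    ∀ (b₀ : ℕ → ℂ) (g g' f f' : ℝ → ℂ) (a₂ : ℕ → ℂ) (θg θf : ℝ),
      ShortPiece θg g g' → ShortPiece θf f f' → θg + θf ≤ 2 - δ →
      (∀ x ∈ Set.Icc (0:ℝ) 1, ‖g x‖ ≤ 1) → (∀ x ∈ Set.Icc (0:ℝ) 1, ‖f x‖ ≤ 1) →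
      (∀ n, ‖b₀ n‖ ≤ B * ((Nat.divisors n).card : ℝ) ^ 2) → (∀ n : ℕ, D ^ 4 < n → b₀ n = 0) →
      (∀ n, ‖a₂ n‖ ≤ B * ((Nat.divisors n).card : ℝ)) → (∀ n : ℕ, D ^ 4 < n → a₂ n = 0) →
        ‖lhs81Ext c' χ (Nlong D) (Nsupp D) (longPsiData χ (dilHead D b₀) g f) a₂ -
            (Theta1Ext c' χ (Nlong D) (Nsupp D) (longPsiData χ (dilHead D b₀) g f) a₂ +
              conj (Theta1Ext c' χ (Nsupp D) (Nlong D) (fun n => conj (a₂ n))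
                (fun n => conj (longPsiData χ (dilHead D b₀) g f n))))‖
          ≤ ε * Real.sqrt D * frakP D

/-- **THE TRANSFER, RE-TYPED SHAPE = `LegSplitTransferX2Dil` (OPEN — asserted by no one; the implication a line would have
to prove, not proved here).** The `X₂` conjunct `∃ X₂, TauTwoTablePsi c′ X₂` of `LongPairsGradedTables` (stmt-Parity-20446)
should follow from the three DILATED slots — Leg A `FormulaILongPsiDil`, Leg B `FormulaILongDualDil`, Lemma 8.1
`Lemma81LongPsiDil` — whose classes CONTAIN the cell's data (`upsHead`/`nuHead`, `B = 1`): the `√D` of each slack is repaid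
EXACTLY by the junction prefactor `‖τ(χ)⁻¹‖ = D^{−1/2}` of the kernel lowering `conj τ₂ = −τ(χ)⁻¹·𝔖 + R₁`
(`TauTwoLowering.crossCell_two_lowering`, `norm_inv_tau_eq`; `R₁` dark given the K0-piece statement,
`KnifeEdgeLenZDegreeTauTwoRemainder`), leaving `ε·𝔓 = o(𝔞𝔓)` since `𝔞 ≍ L′(1,χ)² ≫ 1` under (A) (Lemma 5.7); the
would-be proof further consumes the bridging identity `dirPoly (Nlong D) (longPsiData χ (dilHead D (upsHead χ)) g f) =
ψ(D)D^{1−s}G·Q_g·H_f` (owed, S), the short half (`ShortPairsTauTwoDark`, kernel chain), the rescaling of sup-normalised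
profiles by bilinearity, and the main-term COUNTS of DISPLAY #6 v0 §3(b)/§4(b) as theorems. Typed so that the long X₂ cell
reads `⟸ FormulaILongPsiDil ∧ FormulaILongDualDil ∧ Lemma81LongPsiDil` by name (ls-knife-crit-1 O3); K2/K1/P2 and
`LegSplitTransferX2` of `KnifeEdgeLenLongLegSplit` are NOT touched. [cite: Zhang2022LandauSiegel, §8 Lemma 8.1, (8.5) p. 16;
§5 Lemma 5.7 p. 11] -/
def LegSplitTransferX2Dil : Prop :=
  FormulaILongPsiDil c' → FormulaILongDualDil c' → Lemma81LongPsiDil c' →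
    ∃ X₂ : PairFunctional, TauTwoTablePsi c' X₂

end DilCompanions

/-- The cell's ψ-side TINY datum of Leg B, `conj(ν·1_{≤D⁴})`, is in the divisor class `g = 1` with `B = 1`
(conjugation preserves the norm). [cite: Zhang2022LandauSiegel, §3 (3.1) p. 6; §8 Lemma 8.1 p. 16] -/
theorem conj_nuHead_norm_le {D : ℕ} (χ : DirichletCharacter ℂ D) (n : ℕ) :
    ‖conj (nuHead χ n)‖ ≤ 1 * ((Nat.divisors n).card : ℝ) := by
  rw [Complex.norm_conj]; exact nuHead_norm_le χ n

/-- … and vanishes above `D⁴`. [cite: Zhang2022LandauSiegel, §4 Lemma 4.8 p. 9] -/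
theorem conj_nuHead_eq_zero {D : ℕ} (χ : DirichletCharacter ℂ D) {n : ℕ} (hn : D ^ 4 < n) :
    conj (nuHead χ n) = 0 := by
  rw [nuHead_eq_zero χ hn, map_zero]

end Literature.NumberTheory.LFunctions.Zhang2022.KnifeEdge.LongLegSplit

end
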